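/-
Origin: expansion seat `planner-pub-hodgecm-pv11-g6-0`, handover #1 2026-08-18T09:43:02Z (`HOME/pub-hodgecm-pv11-g6/lean/Pv11g6/SeesawCharTypes.lean`, md5 78074bfa, 561 lines);
landed by the gen-7 packager in gate run 28 as `HodgeCM/PerL34/SeesawCharTypes.lean` (import ^import Pv[0-9]+g[0-9]+\.→import HodgeCM.PerL34. ×1).
-/
/-
Copyright: pub-hodgecm cell, unit pub-hodgecm-pv11-g6 (DAG-NODE PROVER #11, gen 6). Mathlib + tree + own lineage only.
Origin / target: `HOME/pub-hodgecm-pv11-g6/lean/Pv11g6/SeesawCharTypes.lean` → `HodgeCM/PerL34/SeesawCharTypes.lean`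
(packager rewrites the single `import Pv11g5.RealPlaceCircles` to `import HodgeCM.PerL34.RealPlaceCircles`; the
other one is a tree module).  Not to be confused with pv10's landed `HodgeCM.PerL34.InfinityType` (∞-types of unitary
HECKE characters of `GL₁`, node N15): this file is about the characters of PerL's tori `U(W_j)`, `T = U(W₁) × U(W₂)`
(nodes of the pv11 lineage) and imports nothing of it.
-/
import Summits.HodgeConjecture.HodgeCM.PerL34.RealPlaceCircles
import Summits.HodgeConjecture.HodgeCM.PerL34.CircleCharacters

/-!
# Types of torus characters: the character groups of PerL's archimedean tori and the infinity type of an automorphic character of `[U(W_j)]` / `[T]`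

Source under adjudication (NOT cited; this file PROVES what it uses): PerL (`PerL-v5-FULL-d912a121.tex`).
PerL speaks of "the infinity type" of an automorphic character of `[\U(1)]` as a well-defined tuple of integers:

* ll. 274–275 (Def. 3.2, verbatim fragment): "an automorphic character $\chi'_i$ of $[\U(W_i)]=[\U(1)]$";
* l. 481 (Lemma 4.1(a), verbatim fragment): "then $\chi'_{i,b}(u)=u^{e_b(\Psi_i)}$ for all $b$";
* ll. 485–486 (Lemma 4.1(b), verbatim fragment): "on which $T_b=\U(W_{1,b})\times\U(W_{2,b})$ acts by the
  character $-w_b:=(-e_b(\Psi_1),-e_b(\Psi_2))$";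
* ll. 528–530 (Lemma 4.2, verbatim fragments): "(a) For every $e=(e_b)_b\in\Z^{\{b\}}$ there is an automorphic character
  $\chi'$ of $[\U(1)]=\U(1)(L_0)\backslash\A^1_L$ with $\chi'_b(u)=u^{e_b}$ at every real place. (b) If … and $\chi'_i$
  has infinity type $e(\Psi_i)$ …" (l. 530); ll. 644–645 (§4.3): "For an automorphic character $\chi'_i$ of $[\U(W_i)]$ of
  archimedean type $e(\Psi_i)$";
* ll. 427–429 (Prop. 3.6 Step 2, verbatim fragment): "at a character $\chi$ of the compact abelian group $[T]$ is
  $P_{T,\bar\chi}(R(h_f)v)$, which equals $P_{T,\bar\chi}(R(h_f)v_{\chi_\infty})$ (the other $T(L_0\otimes\R)$-isotypic parts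
  integrate to zero against $\chi$)" — `χ_∞` for an ARBITRARY character `χ` of `[T]`.

All of these presuppose the (standard) computation of the character groups of the compact tori
`\U(W_j)(L_0\otimes\R)=\prod_b\U(1)` and `T(L_0\otimes\R)`: their continuous characters are EXACTLY the integer tuples
`(e_b)_b` resp. pairs of tuples, and consequently every automorphic character `χ'` of `[\U(W_j)]` HAS exactly one
infinity type.  Nodes 1/3/4/5 of this lineage (`SeesawTorus`, `UnitaryLineChars`, `SeesawChars`, `RealPlaceCircles`)
proved existence of characters of every type and UNIQUENESS of the type; this file proves EXISTENCE of the type of every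
character, so that "the infinity type of `χ'`" becomes a function.

## What is proved (kernel; nothing cited, nothing posited)

For the CM field `L` (`L⁺ = maximalRealSubfield L`, infinite places `w` of `L` ↔ real places `b` of `L₀ = L⁺` via
Mathlib's `IsCMField.equivInfinitePlace`):

1. `NumberField.existsUnique_eq_archWeightCircle` / `existsUnique_eq_archWeight` — **every continuous character of
   `U(W_j)(L₀ ⊗ ℝ) = unitaryLineArchTorus L` (valued in `S¹`, resp. in `ℂ`) is `archWeightCircle L m`, resp. `archWeight L m`,
   for a UNIQUE `m : InfinitePlace L → ℤ`**; packaged as the type map `NumberField.archCharType` and the group isomorphism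
   `NumberField.archWeightDualEquiv : Multiplicative (InfinitePlace L → ℤ) ≃* PontryaginDual (unitaryLineArchTorus L)`
   ("the characters of `∏_b U(1)` are the `(e_b)_b ∈ ℤ^{b}`").  Ingredients BY NAME: pv01's classification of the continuous
   characters of `U(1)` (`HodgeCM.PerL34.CircleChar.existsUnique_zpow(_complex)`, run 19), node 4's one-place subtori
   `archCoord` with `monoidHom_ext_archCoord` and `archWeight(Circle)_injective`, node 5's `continuous_archCoord`.
2. `NumberField.SeesawArchTorus.existsUnique_eq_weight` — the same for `T(L₀ ⊗ ℝ) = SeesawArchTorus L`: every continuous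
   character `T(L₀⊗ℝ) →* ℂ` is the typed weight `SeesawArchTorus.weight L m₁ m₂` for a unique pair `(m₁, m₂)`.
3. `NumberField.SeesawTorus.infinityType χ : InfinitePlace L → ℤ` — **the infinity type of an automorphic character `χ` of
   `[U(W_j)]`**, with `hasArchType_infinityType`, `hasArchType_iff_infinityType_eq : HasArchType L χ m ↔ infinityType χ = m`,
   `existsUnique_hasArchType`, `infinityType_one / _mul / _inv`, the homomorphism `infinityTypeHom`, its SURJECTIVITY
   (= Lemma 4.2(a), node 3 `NumberField.exists_pontryaginDual_hasArchType` by name), and the literal real-place reading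
   `SeesawTorus.apply_realPlaceCircleQuot : χ (toQ_b u) = u ^ (infinityTypeReal χ b)` (l. 481 / l. 529 "χ'_b(u) = u^{e_b}").
4. `NumberField.SeesawTorus.seesawType ξ := (infinityType χ′₁, infinityType χ′₂)` for a character `ξ = (χ′₁, χ′₂)` of `[T]`:
   `mem_allowedChars_iff_seesawType_eq`, `allowedChars_eq_preimage_seesawType`, `iUnion_allowedChars`,
   `existsUnique_mem_allowedChars` — **the dual of `[T]` is the disjoint union of node 4's index sets `allowedChars L m₁ m₂`**
   — and, for EVERY `ξ`, the typed `ξ_∞`: `toComplexChar_comp_toQuot_eq_weight :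
   (toComplexChar ξ).comp cl = SeesawArchTorus.weight L (seesawType ξ).1 (seesawType ξ).2` (the `χ_∞` of l. 428).
-/

set_option autoImplicit false

noncomputable section

open Topology Set Function

namespace NumberField

/-! ## §1  The character group of `U(W_j)(L₀ ⊗ ℝ) = ∏_b U(1)` is `ℤ^{b}` -/

section ArchDual

variable (L : Type) [Field L] [NumberField L] [IsCMField L]

/-- **Every continuous character `U(W_j)(L₀ ⊗ ℝ) →* S¹` is a typed weight `t ↦ ∏_w ι_w(t_w)^{m_w}` for a unique type `m`.** -/
theorem existsUnique_eq_archWeightCircle (χ : unitaryLineArchTorus L →* Circle) (hχ : Continuous χ) :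
    ∃! m : InfinitePlace L → ℤ, χ = archWeightCircle L m := by
  have key : ∀ w : InfinitePlace L, ∃! n : ℤ, ∀ z : Circle, χ (archCoord L w z) = z ^ n := fun w =>
    HodgeCM.PerL34.CircleChar.existsUnique_zpow (χ.comp (archCoord L w)) (hχ.comp (continuous_archCoord L w))
  have hm : χ = archWeightCircle L fun w => (key w).choose :=
    monoidHom_ext_archCoord L fun w z => by rw [(key w).choose_spec.1 z, archWeightCircle_archCoord]
  exact ⟨fun w => (key w).choose, hm, fun m' hm' => archWeightCircle_injective (hm'.symm.trans hm)⟩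

/-- **Every continuous character `U(W_j)(L₀ ⊗ ℝ) →* ℂ` is `archWeight L m` for a unique type `m`** (such a character is
automatically unitary). -/
theorem existsUnique_eq_archWeight (χ : unitaryLineArchTorus L →* ℂ) (hχ : Continuous χ) :
    ∃! m : InfinitePlace L → ℤ, χ = archWeight L m := by
  have key : ∀ w : InfinitePlace L, ∃! n : ℤ, ∀ z : Circle, χ (archCoord L w z) = (z : ℂ) ^ n := fun w =>
    HodgeCM.PerL34.CircleChar.existsUnique_zpow_complex (χ.comp (archCoord L w)) (hχ.comp (continuous_archCoord L w))
  have hm : χ = archWeight L fun w => (key w).choose :=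
    monoidHom_ext_archCoord L fun w z => by rw [(key w).choose_spec.1 z, archWeight_archCoord, Circle.coe_zpow]
  exact ⟨fun w => (key w).choose, hm, fun m' hm' => archWeight_injective (hm'.symm.trans hm)⟩

/-- **The type of a continuous character of `U(W_j)(L₀ ⊗ ℝ)`**: the unique `m` with `χ = archWeightCircle L m`. -/
def archCharType (χ : PontryaginDual (unitaryLineArchTorus L)) : InfinitePlace L → ℤ :=
  (existsUnique_eq_archWeightCircle L (χ : unitaryLineArchTorus L →* Circle) χ.continuous).choose

/-- (Ported verbatim from the HodgeCMPerL package; no docstring in the source.) -/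
theorem eq_archWeightCircle_archCharType (χ : PontryaginDual (unitaryLineArchTorus L)) :
    (χ : unitaryLineArchTorus L →* Circle) = archWeightCircle L (archCharType L χ) :=
  (existsUnique_eq_archWeightCircle L (χ : unitaryLineArchTorus L →* Circle) χ.continuous).choose_spec.1

/-- (Ported verbatim from the HodgeCMPerL package; no docstring in the source.) -/
theorem apply_eq_archWeightCircle_archCharType (χ : PontryaginDual (unitaryLineArchTorus L)) (t : unitaryLineArchTorus L) :
    χ t = archWeightCircle L (archCharType L χ) t :=
  DFunLike.congr_fun (eq_archWeightCircle_archCharType L χ) t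

/-- (Ported verbatim from the HodgeCMPerL package; no docstring in the source.) -/
theorem archCharType_eq_iff (χ : PontryaginDual (unitaryLineArchTorus L)) (m : InfinitePlace L → ℤ) :
    archCharType L χ = m ↔ (χ : unitaryLineArchTorus L →* Circle) = archWeightCircle L m := by
  constructor
  · rintro rfl
    exact eq_archWeightCircle_archCharType L χ
  · intro h
    exact ((existsUnique_eq_archWeightCircle L (χ : unitaryLineArchTorus L →* Circle) χ.continuous).choose_spec.2 m h).symm

/-- On the one-place subtorus at `w` a continuous character is `z ↦ z ^ (archCharType χ w)`. -/
theorem pontryaginDual_apply_archCoord (χ : PontryaginDual (unitaryLineArchTorus L)) (w : InfinitePlace L) (z : Circle) :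
    χ (archCoord L w z) = z ^ (archCharType L χ w) := by
  rw [apply_eq_archWeightCircle_archCharType, archWeightCircle_archCoord]

/-- The typed weight of type `m` as a continuous unitary character. -/
def archWeightDual (m : InfinitePlace L → ℤ) : PontryaginDual (unitaryLineArchTorus L) :=
  { archWeightCircle L m with continuous_toFun := continuous_archWeightCircle L m }

/-- (Ported verbatim from the HodgeCMPerL package; no docstring in the source.) -/
@[simp] theorem archWeightDual_apply (m : InfinitePlace L → ℤ) (t : unitaryLineArchTorus L) :
    archWeightDual L m t = archWeightCircle L m t := rfl

/-- (Ported verbatim from the HodgeCMPerL package; no docstring in the source.) -/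
theorem coe_archWeightDual (m : InfinitePlace L → ℤ) :
    (archWeightDual L m : unitaryLineArchTorus L →* Circle) = archWeightCircle L m := rfl

/-- (Ported verbatim from the HodgeCMPerL package; no docstring in the source.) -/
@[simp] theorem archCharType_archWeightDual (m : InfinitePlace L → ℤ) : archCharType L (archWeightDual L m) = m :=
  (archCharType_eq_iff L _ m).mpr rfl

/-- (Ported verbatim from the HodgeCMPerL package; no docstring in the source.) -/
@[simp] theorem archWeightDual_archCharType (χ : PontryaginDual (unitaryLineArchTorus L)) :
    archWeightDual L (archCharType L χ) = χ :=
  ContinuousMonoidHom.ext fun t => (apply_eq_archWeightCircle_archCharType L χ t).symm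

/-- (Ported verbatim from the HodgeCMPerL package; no docstring in the source.) -/
theorem archCharType_injective : Injective (archCharType L) := fun χ χ' h => by
  rw [← archWeightDual_archCharType L χ, ← archWeightDual_archCharType L χ', h]

/-- (Ported verbatim from the HodgeCMPerL package; no docstring in the source.) -/
theorem archCharType_surjective : Surjective (archCharType L) := fun m => ⟨archWeightDual L m, archCharType_archWeightDual L m⟩

/-- (Ported verbatim from the HodgeCMPerL package; no docstring in the source.) -/
theorem archWeightDual_injective : Injective (archWeightDual L) := fun m m' h => by
  rw [← archCharType_archWeightDual L m, ← archCharType_archWeightDual L m', h]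

/-- (Ported verbatim from the HodgeCMPerL package; no docstring in the source.) -/
theorem archWeightDual_surjective : Surjective (archWeightDual L) := fun χ => ⟨archCharType L χ, archWeightDual_archCharType L χ⟩

/-- (Ported verbatim from the HodgeCMPerL package; no docstring in the source.) -/
theorem archWeightCircle_zero : archWeightCircle L 0 = 1 := by
  refine MonoidHom.ext fun t => Subtype.val_injective ?_
  change archWeight L 0 t = ((1 : Circle) : ℂ)
  rw [archWeight_zero, Circle.coe_one]

/-- (Ported verbatim from the HodgeCMPerL package; no docstring in the source.) -/
theorem archWeightCircle_add (m m' : InfinitePlace L → ℤ) :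
    archWeightCircle L (m + m') = archWeightCircle L m * archWeightCircle L m' := by
  refine MonoidHom.ext fun t => Subtype.val_injective ?_
  change archWeight L (m + m') t = ((archWeightCircle L m t * archWeightCircle L m' t : Circle) : ℂ)
  rw [archWeight_add, Circle.coe_mul]
  rfl

/-- (Ported verbatim from the HodgeCMPerL package; no docstring in the source.) -/
theorem archWeightDual_zero : archWeightDual L 0 = 1 :=
  ContinuousMonoidHom.ext fun t => DFunLike.congr_fun (archWeightCircle_zero L) t

/-- (Ported verbatim from the HodgeCMPerL package; no docstring in the source.) -/
theorem archWeightDual_add (m m' : InfinitePlace L → ℤ) :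
    archWeightDual L (m + m') = archWeightDual L m * archWeightDual L m' :=
  ContinuousMonoidHom.ext fun t => DFunLike.congr_fun (archWeightCircle_add L m m') t

/-- (Ported verbatim from the HodgeCMPerL package; no docstring in the source.) -/
theorem archCharType_one : archCharType L 1 = 0 := by
  rw [← archWeightDual_zero, archCharType_archWeightDual]

/-- (Ported verbatim from the HodgeCMPerL package; no docstring in the source.) -/
theorem archCharType_mul (χ χ' : PontryaginDual (unitaryLineArchTorus L)) :
    archCharType L (χ * χ') = archCharType L χ + archCharType L χ' := by
  conv_lhs => rw [← archWeightDual_archCharType L χ, ← archWeightDual_archCharType L χ', ← archWeightDual_add]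
  rw [archCharType_archWeightDual]

/-- (Ported verbatim from the HodgeCMPerL package; no docstring in the source.) -/
theorem archCharType_inv (χ : PontryaginDual (unitaryLineArchTorus L)) : archCharType L χ⁻¹ = -archCharType L χ := by
  have h := archCharType_mul L χ χ⁻¹
  rw [mul_inv_cancel, archCharType_one] at h
  exact (neg_eq_of_add_eq_zero_right h.symm).symm

/-- **`\widehat{U(W_j)(L₀ ⊗ ℝ)} = ℤ^{b}`**: the typed weights give a group isomorphism from the (additive) group of types
onto the Pontryagin dual of the archimedean torus. -/
def archWeightDualEquiv : Multiplicative (InfinitePlace L → ℤ) ≃* PontryaginDual (unitaryLineArchTorus L) where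
  toFun m := archWeightDual L m.toAdd
  invFun χ := Multiplicative.ofAdd (archCharType L χ)
  left_inv m := by simp
  right_inv χ := by simp
  map_mul' m m' := by
    change archWeightDual L (m.toAdd + m'.toAdd) = _
    exact archWeightDual_add L _ _

/-- (Ported verbatim from the HodgeCMPerL package; no docstring in the source.) -/
@[simp] theorem archWeightDualEquiv_apply (m : Multiplicative (InfinitePlace L → ℤ)) :
    archWeightDualEquiv L m = archWeightDual L m.toAdd := rfl

/-- (Ported verbatim from the HodgeCMPerL package; no docstring in the source.) -/
@[simp] theorem archWeightDualEquiv_symm_apply (χ : PontryaginDual (unitaryLineArchTorus L)) :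
    (archWeightDualEquiv L).symm χ = Multiplicative.ofAdd (archCharType L χ) := rfl

end ArchDual

/-! ## §2  The character group of `T(L₀ ⊗ ℝ) = U(W₁)(L₀⊗ℝ) × U(W₂)(L₀⊗ℝ)` is `ℤ^{b} × ℤ^{b}` -/

namespace SeesawArchTorus

variable (L : Type) [Field L] [NumberField L] [IsCMField L]

/-- (Ported verbatim from the HodgeCMPerL package; no docstring in the source.) -/
theorem continuous_fst : Continuous (fst L) := _root_.continuous_fst
/-- (Ported verbatim from the HodgeCMPerL package; no docstring in the source.) -/
theorem continuous_snd : Continuous (snd L) := _root_.continuous_snd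
/-- (Ported verbatim from the HodgeCMPerL package; no docstring in the source.) -/
theorem continuous_inl : Continuous (inl L) := continuous_id.prodMk continuous_const
/-- (Ported verbatim from the HodgeCMPerL package; no docstring in the source.) -/
theorem continuous_inr : Continuous (inr L) := continuous_const.prodMk continuous_id

variable {L} in
/-- The typed weight is determined by its two types. -/
theorem weight_injective2 {m₁ m₂ m₁' m₂' : InfinitePlace L → ℤ} (h : weight L m₁ m₂ = weight L m₁' m₂') :
    m₁ = m₁' ∧ m₂ = m₂' := by
  refine ⟨archWeight_injective (MonoidHom.ext fun t => ?_), archWeight_injective (MonoidHom.ext fun t => ?_)⟩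
  · rw [← weight_inl m₁ m₂, h, weight_inl]
  · rw [← weight_inr m₁ m₂, h, weight_inr]

/-- **Every continuous character `T(L₀ ⊗ ℝ) →* ℂ` is a typed weight `w(m₁, m₂)` for a unique pair of types** — the
characters of `T_b = U(W_{1,b}) × U(W_{2,b})`, collected over the real places `b`, are the pairs of integer tuples
(ll. 485–486 "acts by the character $-w_b:=(-e_b(\Psi_1),-e_b(\Psi_2))$"). -/
theorem existsUnique_eq_weight (χ : SeesawArchTorus L →* ℂ) (hχ : Continuous χ) :
    ∃! p : (InfinitePlace L → ℤ) × (InfinitePlace L → ℤ), χ = weight L p.1 p.2 := by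
  obtain ⟨m₁, hm₁, -⟩ := existsUnique_eq_archWeight L (χ.comp (inl L)) (hχ.comp (continuous_inl L))
  obtain ⟨m₂, hm₂, -⟩ := existsUnique_eq_archWeight L (χ.comp (inr L)) (hχ.comp (continuous_inr L))
  have h : χ = weight L m₁ m₂ := by
    refine MonoidHom.ext fun t => ?_
    rw [← mk_fst_snd t, ← inl_mul_inr, map_mul, map_mul, weight_inl, weight_inr]
    exact congrArg₂ (· * ·) (DFunLike.congr_fun hm₁ (fst L t)) (DFunLike.congr_fun hm₂ (snd L t))
  refine ⟨(m₁, m₂), h, fun p hp => ?_⟩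
  obtain ⟨h₁, h₂⟩ := weight_injective2 (hp.symm.trans h)
  exact Prod.ext h₁ h₂

end SeesawArchTorus

/-! ## §3  The infinity type of an automorphic character of `[U(W_j)]` -/

namespace SeesawTorus

section InfinityType

variable {L : Type} [Field L] [NumberField L] [IsCMField L]

local notation "L⁺" => maximalRealSubfield L

omit [IsCMField L] in
/-- `χ′_∞ := χ′ ∘ cl_j : U(W_j)(L₀ ⊗ ℝ) →* ℂ` is continuous. -/
theorem continuous_toComplexChar_comp_archToQuot (χ : PontryaginDual (relNormOneIdeles L⁺ L ⧸ relNormOneRat L⁺ L)) :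
    Continuous ((toComplexChar χ).comp (unitaryLineArchToQuot L)) :=
  continuous_subtype_val.comp (χ.continuous.comp (continuous_relNormOneInfToQuot L⁺ L))

/-- **Every automorphic character of `[U(W_j)]` has exactly one infinity type.** -/
theorem existsUnique_hasArchType (χ : PontryaginDual (relNormOneIdeles L⁺ L ⧸ relNormOneRat L⁺ L)) :
    ∃! m : InfinitePlace L → ℤ, HasArchType L χ m :=
  existsUnique_eq_archWeight L _ (continuous_toComplexChar_comp_archToQuot χ)

/-- **The infinity type `(e_b)_b` of an automorphic character `χ′` of `[U(W_j)] = [U(1)]`** (indexed by the infinite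
places `w` of `L`; see `infinityTypeReal` for the indexing by the real places `b` of `L₀`): the unique `m` with
`χ′ ∘ cl_j = (t ↦ ∏_w ι_w(t_w)^{m_w})`. -/
def infinityType (χ : PontryaginDual (relNormOneIdeles L⁺ L ⧸ relNormOneRat L⁺ L)) : InfinitePlace L → ℤ :=
  (existsUnique_hasArchType χ).choose

/-- `χ′` has its infinity type. -/
theorem hasArchType_infinityType (χ : PontryaginDual (relNormOneIdeles L⁺ L ⧸ relNormOneRat L⁺ L)) :
    HasArchType L χ (infinityType χ) :=
  (existsUnique_hasArchType χ).choose_spec.1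

/-- **`χ′` has archimedean type `m` iff `m` is its infinity type** — node 1's relation `HasArchType` is the graph of
the function `infinityType`. -/
theorem hasArchType_iff_infinityType_eq (χ : PontryaginDual (relNormOneIdeles L⁺ L ⧸ relNormOneRat L⁺ L))
    (m : InfinitePlace L → ℤ) : HasArchType L χ m ↔ infinityType χ = m :=
  ⟨fun h => HasArchType.unique (hasArchType_infinityType χ) h, fun h => h ▸ hasArchType_infinityType χ⟩

/-- `χ′_∞ = archWeight (infinityType χ′)` as homomorphisms `U(W_j)(L₀ ⊗ ℝ) →* ℂ`. -/
theorem toComplexChar_comp_archToQuot (χ : PontryaginDual (relNormOneIdeles L⁺ L ⧸ relNormOneRat L⁺ L)) :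
    (toComplexChar χ).comp (unitaryLineArchToQuot L) = archWeight L (infinityType χ) :=
  hasArchType_infinityType χ

/-- Pointwise: `χ′(cl_j t) = ∏_w ι_w(t_w)^{(infinityType χ′)_w}`. -/
theorem apply_archToQuot (χ : PontryaginDual (relNormOneIdeles L⁺ L ⧸ relNormOneRat L⁺ L)) (t : unitaryLineArchTorus L) :
    ((χ (unitaryLineArchToQuot L t) : Circle) : ℂ) = archWeight L (infinityType χ) t :=
  (hasArchType_iff χ _).mp (hasArchType_infinityType χ) t

/-- On the one-place subtorus at `w`: `χ′(cl_j (archCoord w z)) = z ^ (infinityType χ′ w)`. -/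
theorem apply_archToQuot_archCoord (χ : PontryaginDual (relNormOneIdeles L⁺ L ⧸ relNormOneRat L⁺ L))
    (w : InfinitePlace L) (z : Circle) :
    χ (unitaryLineArchToQuot L (archCoord L w z)) = z ^ (infinityType χ w) :=
  (hasArchType_iff_forall_place χ _).mp (hasArchType_infinityType χ) w z

/-- The infinity type of `χ′` is the type of the continuous character `χ′ ∘ cl_j` of the archimedean torus (§1). -/
theorem infinityType_eq_archCharType (χ : PontryaginDual (relNormOneIdeles L⁺ L ⧸ relNormOneRat L⁺ L)) :
    infinityType χ = archCharType L (χ.comp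
      { relNormOneInfToQuot L⁺ L with continuous_toFun := continuous_relNormOneInfToQuot L⁺ L }) := by
  symm
  rw [archCharType_eq_iff]
  exact monoidHom_ext_archCoord L fun w z => by
    rw [archWeightCircle_archCoord, ← apply_archToQuot_archCoord χ w z]
    rfl

/-- (Ported verbatim from the HodgeCMPerL package; no docstring in the source.) -/
@[simp] theorem infinityType_one :
    infinityType (1 : PontryaginDual (relNormOneIdeles L⁺ L ⧸ relNormOneRat L⁺ L)) = 0 :=
  (hasArchType_iff_infinityType_eq _ _).mp hasArchType_one

/-- (Ported verbatim from the HodgeCMPerL package; no docstring in the source.) -/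
theorem infinityType_mul (χ χ' : PontryaginDual (relNormOneIdeles L⁺ L ⧸ relNormOneRat L⁺ L)) :
    infinityType (χ * χ') = infinityType χ + infinityType χ' :=
  (hasArchType_iff_infinityType_eq _ _).mp ((hasArchType_infinityType χ).mul (hasArchType_infinityType χ'))

/-- (Ported verbatim from the HodgeCMPerL package; no docstring in the source.) -/
theorem infinityType_inv (χ : PontryaginDual (relNormOneIdeles L⁺ L ⧸ relNormOneRat L⁺ L)) :
    infinityType χ⁻¹ = -infinityType χ :=
  (hasArchType_iff_infinityType_eq _ _).mp (hasArchType_infinityType χ).inv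

/-- (Ported verbatim from the HodgeCMPerL package; no docstring in the source.) -/
theorem infinityType_div (χ χ' : PontryaginDual (relNormOneIdeles L⁺ L ⧸ relNormOneRat L⁺ L)) :
    infinityType (χ / χ') = infinityType χ - infinityType χ' := by
  rw [div_eq_mul_inv, infinityType_mul, infinityType_inv, sub_eq_add_neg]

/-- (Ported verbatim from the HodgeCMPerL package; no docstring in the source.) -/
theorem infinityType_pow (χ : PontryaginDual (relNormOneIdeles L⁺ L ⧸ relNormOneRat L⁺ L)) (n : ℕ) :
    infinityType (χ ^ n) = n • infinityType χ := by
  induction n with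
  | zero => rw [pow_zero, infinityType_one, zero_smul]
  | succ n ih => rw [pow_succ, infinityType_mul, ih, succ_nsmul]

variable (L) in
/-- **The infinity type is a group homomorphism** `\widehat{[U(W_j)]} → ℤ^{b}` (characters multiply, types add). -/
def infinityTypeHom :
    PontryaginDual (relNormOneIdeles L⁺ L ⧸ relNormOneRat L⁺ L) →* Multiplicative (InfinitePlace L → ℤ) where
  toFun χ := Multiplicative.ofAdd (infinityType χ)
  map_one' := by rw [infinityType_one]; rfl
  map_mul' χ χ' := by rw [infinityType_mul]; rfl

/-- (Ported verbatim from the HodgeCMPerL package; no docstring in the source.) -/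
@[simp] theorem infinityTypeHom_apply (χ : PontryaginDual (relNormOneIdeles L⁺ L ⧸ relNormOneRat L⁺ L)) :
    infinityTypeHom L χ = Multiplicative.ofAdd (infinityType χ) := rfl

/-- **Lemma 4.2(a) as surjectivity**: every type `e ∈ ℤ^{b}` is the infinity type of some automorphic character of
`[U(W_j)]` (node 3 `NumberField.exists_pontryaginDual_hasArchType`, by name). -/
theorem infinityType_surjective :
    Surjective (infinityType : PontryaginDual (relNormOneIdeles L⁺ L ⧸ relNormOneRat L⁺ L) → InfinitePlace L → ℤ) := by
  intro m
  obtain ⟨χ, hχ⟩ := NumberField.exists_pontryaginDual_hasArchType L m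
  exact ⟨χ, (hasArchType_iff_infinityType_eq χ m).mp hχ⟩

/-- (Ported verbatim from the HodgeCMPerL package; no docstring in the source.) -/
theorem infinityTypeHom_surjective : Surjective (infinityTypeHom L) := fun m => by
  obtain ⟨χ, hχ⟩ := infinityType_surjective (L := L) m.toAdd
  exact ⟨χ, by rw [infinityTypeHom_apply, hχ]; rfl⟩

/-- The characters of infinity type `0` are exactly those trivial on the image of `U(W_j)(L₀ ⊗ ℝ)` (the kernel of the
type homomorphism). -/
theorem infinityType_eq_zero_iff (χ : PontryaginDual (relNormOneIdeles L⁺ L ⧸ relNormOneRat L⁺ L)) :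
    infinityType χ = 0 ↔ ∀ t : unitaryLineArchTorus L, χ (unitaryLineArchToQuot L t) = 1 := by
  rw [← hasArchType_iff_infinityType_eq, hasArchType_iff]
  refine forall_congr' fun t => ?_
  rw [archWeight_zero, ← Circle.coe_one]
  exact ⟨fun h => Subtype.val_injective h, fun h => congrArg Subtype.val h⟩


-- port_pkg: scope closed for this part
end InfinityType
end SeesawTorus
end NumberField
end
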